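/-
Copyright (c) 2026. All rights reserved.
Released under Apache 2.0 license as described in the file LICENSE.
Authors: abc-iut cell, prover seat abc-iut-w4-d094 (wave 4, gen 7).
-/
import Literature.IUT.LogVolume.TensorPacketLicenceCellConjugate
import HarnessLib

/-!
# The per-summand (xi-f) inclusion from ONE-SIDED shell-radius witnesses: the SUFFICIENCY half of abc-iut-c312-5's
# exact cell, with the inner ball and the maximality of the outer element dropped

abc-iut cell, seat abc-iut-w4-d094 (D-0079 sub-cell R-W «WINDOW Θ-SIDE INEQUALITY», lane P+ «prove S_H per datum», W1 row
composer; tool file for EVERY inhabited-side row).  PROOF-ONLY file (no definitions, no named `Prop` facts).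

WHY.  abc-iut-c312-5's exact per-summand cell `iota_smul_subset_packetHull_orbit_iota_smul_iff` (and its factorwise / orders /
conjugate-family forms by abc-iut-w5-d180) is an `iff` under SIX binders per factor shell `Λ_i = log_p(R_i^×)`: an inner element
`c^in_i` with `hin0`, `hin` (`c^in_i·R_i ⊆ Λ_i`) and `hmax` (some `w ∉ Λ_i` with `‖w‖·‖ϖ_i‖ ≤ ‖c^in_i‖`), and an outer element
`c^out_i` with `hout0`, `houtΛ` (`c^out_i ∈ Λ_i`) and `hdom` (`Λ_i ⊆ {‖·‖ ≤ ‖c^out_i‖}`) — i.e. the EXACT inner and outer radii.  At a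
WILD place of a genuine datum (`ζ_p ∈ K_x`, `p ∣ e_x/(p−1)`: every bad place over `2·3·5` of the R-W table's OPEN rows) the exact inner
radius is not in the tree.  But the direction an INHABITED row consumes («inequality ⇒ q-box ⊆ hull of the (Ind2)-orbit of the
Θ-box») uses only `hin0`/`hmax` and `hout0`/`houtΛ` — in c312-5's own proofs the ⇒-half of `smul_normalizedPacket_subset_logPacket_iff`
uses `hmax` alone and the ⊇-half of `packetHull_zpow_smul_logPacket_eq` uses membership alone.  This file isolates that half:

* §1 `norm_dEquiv_le_of_smul_normalizedPacket_subset_logPacket` — `u·(R_I)^∼ ⊆ log_p(R_I^×) ⟹ ∀ J, ‖ψ_J(u)‖ ≤ p^{−(d_I − d_{L_J})}·∏‖c^in_i‖`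
  for ANY family `c^in` carrying `hmax`-witnesses; `zpow_mul_norm_le_of_iota_smul_subset_zpow_smul_logPacket` — its slot-box / content form.
* §2 `iota_smul_normalizedPacket_subset_packetHull_zpow_smul_logPacket_of_le` — `p^m·‖t‖ ≤ ∏‖c^out_i‖` with `c^out_i ∈ Λ_i`, `c^out_i ≠ 0`
  ⟹ `ι_b(t)·(R_I)^∼ ⊆ hull(p^m·log_p(R_I^×))`.
* §3 **`iota_smul_subset_packetHull_orbit_iota_smul_of_cell`** / **`…factorwiseOrbit…_of_cell`** — with one-sided witnesses,
  `(∀ m, (∀ J, p^m·‖t_Θ‖ ≤ p^{−(d_I − d_{L_J})}·∏‖c^in_i‖) → p^m·‖t_q‖ ≤ ∏‖c^out_i‖) ⟹ M_q ⊆ hull(⋃_{γ} γ·M_Θ)`.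
* §4 **`iota_smul_subset_packetHull_factorwiseOrbit_iota_smul_of_orders_of_algEquiv`** (and the `indTwo` form) — at a packet of
  pairwise isomorphic slots `τ_i : K ≃ k_i` (Galois-conjugate completions), in INTEGER ORDERS with INEQUALITY witnesses:
  `D/e ≤ d_K`, `‖c^in_i‖ ≤ p^{−R_in/e}`, `p^{−R_out/e} ≤ ‖c^out_i‖`, `p^{−M/e} ≤ ‖t_Θ‖`, `‖t_q‖ ≤ p^{−m_q/e}` and
  **`e·((M − (|I|−1)·D − |I|·R_in) / e) + |I|·R_out ≤ m_q` ⟹ inclusion** — the form a genuine INHABITED row evaluates with the CHEAP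
  witnesses `R_in = 1` (any integral non-logarithm), `R_out = p^{a₀} − e·a₀` (`log_p(1+ϖ)`, abc-iut-c312-3's envelope) and `D = e − 1`.

Monotonicity (why inequalities suffice): a larger `∏‖c^in‖`, a smaller `∏‖c^out‖`, a smaller `‖t_Θ‖` or a larger `‖t_q‖` only make the
displayed predicate harder.  HONEST SCOPE: lattice algebra over the cell's typed containers and Dupuy–Hilado's typed (Ind2) (and print's
factorwise (Ind2)); the per-summand hull inclusion is a STRONGER-THAN-PRINT reading of [IUTchIII] Cor. 3.12 Step (xi-f); nothing here bears on
the printed inequality or the number-level corollary; no side taken on Cor. 3.12 or on any author. [cite: Mochizuki2012, IUTchIII Thm. 3.11 (i)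
(Ind2) p. 154; IUTchIV Prop. 1.1 p. 9, Prop. 1.2 (i)(ii) p. 10] [cite: DupuyHilado2025, §4.9, §4.12] [cite: WeilBNT1967, Ch. II §2, Th. 1–2]
[claim: Mochizuki2012, status: disputed] for the (Ind2)/hull locutions only.
-/

noncomputable section

open Set Module Function
open scoped Pointwise TensorProduct NormedField nonZeroDivisors

namespace Literature.IUT.LogVolume

open Literature.NumberTheory.GaloisRepresentations.Ultrametric

variable (p : ℕ) [hp : Fact p.Prime]
variable {I : Type} [Fintype I] [DecidableEq I] [Nonempty I]
variable (k : I → Type) [∀ i, NontriviallyNormedField (k i)] [∀ i, NormedAlgebra ℚ_[p] (k i)]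
  [∀ i, IsUltrametricDist (k i)] [∀ i, ProperSpace (k i)]

/-! ## 1. Necessity half of the content criterion from `hmax`-witnesses alone -/

/-- **`u·(R_I)^∼ ⊆ log_p(R_I^×) ⟹ ∀ J, ‖ψ_J(u)‖ ≤ p^{−(d_I − d_{L_J})}·∏_i ‖c^in_i‖`** for ANY nonzero `c^in_i` such that some
`w_i ∉ log_p(R_i^×)` has `‖w_i‖·‖ϖ_i‖ ≤ ‖c^in_i‖` (no inner ball is assumed): abc-iut-c312-5's trace-dual test elements
(`exists_traceDual_logUnits_norm_ge`, `norm_dEquiv_mul_prod_le_of_smul_normalizedPacket_subset_logPacket`) read one-sidedly.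
[cite: Mochizuki2012, IUTchIV Prop. 1.1 p. 9] [cite: WeilBNT1967, Ch. II §2, Th. 1] -/
theorem norm_dEquiv_le_of_smul_normalizedPacket_subset_logPacket {c : Π i, k i} (hc0 : ∀ i, c i ≠ 0)
    (hmax : ∀ i, ∃ (ϖ : (k i)ˣ) (w : k i), IsUniformizer ϖ ∧ w ∉ logUnits (k i) ∧ ‖w‖ * ‖(ϖ : k i)‖ ≤ ‖c i‖)
    {u : PacketAlgebra p k}
    (hu : u • (normalizedPacket p k : Set (PacketAlgebra p k)) ⊆ (logPacket p k : Set (PacketAlgebra p k)))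
    (J : DIdx p k) :
    ‖dEquiv p k u J‖ ≤ (p : ℝ) ^ (-(dSum p k - differentOrd p (DFac p k J))) * ∏ i, ‖c i‖ := by
  have hp0 : (0 : ℝ) < p := by exact_mod_cast hp.out.pos
  -- generators of the differents and maximal test elements at every factor
  have hgen := fun i => exists_different_eq_span p (k i)
  choose δ hδ using hgen
  have hwit : ∀ i, ∃ y : k i, (∀ z ∈ logUnits (k i), ‖Algebra.trace ℚ_[p] (k i) (y * z)‖ ≤ 1) ∧
      1 ≤ ‖(δ i : k i)‖ * ‖y‖ * ‖c i‖ := fun i => by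
    obtain ⟨ϖ, w, hϖ, hw, hwc⟩ := hmax i
    exact exists_traceDual_logUnits_norm_ge (p := p) (hδ i) hϖ (hc0 i) hw hwc
  choose y hy hy1 using hwit
  have hB := norm_dEquiv_mul_prod_le_of_smul_normalizedPacket_subset_logPacket p k hu hy J
  have hdc : ∀ i, 0 < ‖(δ i : k i)‖ * ‖c i‖ := fun i =>
    mul_pos (norm_pos_iff.mpr (by exact_mod_cast generator_ne_zero p (k i) (hδ i))) (norm_pos_iff.mpr (hc0 i))
  have hyge : ∀ i, (‖(δ i : k i)‖ * ‖c i‖)⁻¹ ≤ ‖y i‖ := fun i => by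
    rw [inv_le_iff_one_le_mul₀ (hdc i)]
    calc (1 : ℝ) ≤ ‖(δ i : k i)‖ * ‖y i‖ * ‖c i‖ := hy1 i
      _ = ‖y i‖ * (‖(δ i : k i)‖ * ‖c i‖) := by ring
  have hprod : ∏ i, (‖(δ i : k i)‖ * ‖c i‖)⁻¹ ≤ ∏ i, ‖y i‖ :=
    Finset.prod_le_prod (fun i _ => (inv_pos.mpr (hdc i)).le) fun i _ => hyge i
  have hprodpos : 0 < ∏ i, (‖(δ i : k i)‖ * ‖c i‖)⁻¹ := Finset.prod_pos fun i _ => inv_pos.mpr (hdc i)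
  have h1 : ‖dEquiv p k u J‖ * ∏ i, (‖(δ i : k i)‖ * ‖c i‖)⁻¹ ≤ (p : ℝ) ^ differentOrd p (DFac p k J) :=
    (mul_le_mul_of_nonneg_left hprod (norm_nonneg _)).trans hB
  rw [← le_div_iff₀ hprodpos] at h1
  refine h1.trans (le_of_eq ?_)
  rw [Finset.prod_inv_distrib, div_inv_eq_mul, Finset.prod_mul_distrib, prod_norm_generators_eq p k δ hδ,
    ← mul_assoc, ← Real.rpow_add hp0,
    show differentOrd p (DFac p k J) + -dSum p k = -(dSum p k - differentOrd p (DFac p k J)) by ring]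

/-- **Content form**: `ι_b(t)·(R_I)^∼ ⊆ p^m·log_p(R_I^×) ⟹ ∀ J, p^m·‖t‖ ≤ p^{−(d_I − d_{L_J})}·∏_i ‖c^in_i‖` for any family of
`hmax`-witnessed `c^in` (the ⇒-half of abc-iut-c312-5's `iota_smul_normalizedPacket_subset_zpow_smul_logPacket_iff`).
[cite: Mochizuki2012, IUTchIV Prop. 1.2 (ii) p. 10] [cite: DupuyHilado2025, §4.9, §4.12] -/
theorem zpow_mul_norm_le_of_iota_smul_subset_zpow_smul_logPacket {c : Π i, k i} (hc0 : ∀ i, c i ≠ 0)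
    (hmax : ∀ i, ∃ (ϖ : (k i)ˣ) (w : k i), IsUniformizer ϖ ∧ w ∉ logUnits (k i) ∧ ‖w‖ * ‖(ϖ : k i)‖ ≤ ‖c i‖)
    (b : I) (t : k b) (m : ℤ)
    (h : iota p k b t • (normalizedPacket p k : Set (PacketAlgebra p k)) ⊆
      ((p : ℚ_[p]) ^ m) • (logPacket p k : Set (PacketAlgebra p k))) (J : DIdx p k) :
    (p : ℝ) ^ m * ‖t‖ ≤ (p : ℝ) ^ (-(dSum p k - differentOrd p (DFac p k J))) * ∏ i, ‖c i‖ := by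
  have hpm0 : ((p : ℚ_[p]) ^ m) ≠ 0 := zpow_ne_zero _ (Nat.cast_ne_zero.mpr hp.out.ne_zero)
  rw [Set.subset_smul_set_iff₀ hpm0, smul_set_eq_algebraMap_smul, smul_smul, ← smul_eq_mul] at h
  have key := norm_dEquiv_le_of_smul_normalizedPacket_subset_logPacket p k hc0 hmax h J
  rwa [smul_eq_mul, map_mul, Pi.mul_apply, norm_mul, AlgEquiv.commutes, Pi.algebraMap_apply, norm_algebraMap',
    norm_inv, Padic.norm_p_zpow, zpow_neg, inv_inv, norm_dEquiv_iota] at key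

/-! ## 2. The q-box inside `hull(p^m·log_p(R_I^×))` from an outer MEMBER -/

/-- **`p^m·‖t‖ ≤ ∏_i ‖c^out_i‖ ⟹ ι_b(t)·(R_I)^∼ ⊆ hull(p^m·log_p(R_I^×))`** for nonzero `c^out_i ∈ log_p(R_i^×)` (no maximality):
`ι_b(t)·(R_I)^∼ ⊆ (p^m·⊗c^out)·(R_I)^∼` coordinatewise, and `⊗c^out ∈ log_p(R_I^×)` (the ⊇-half of abc-iut-c312-5's
`packetHull_zpow_smul_logPacket_eq`). [cite: DupuyHilado2025, §3.7, §4.12] -/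
theorem iota_smul_normalizedPacket_subset_packetHull_zpow_smul_logPacket_of_le {c : Π i, k i} (hc0 : ∀ i, c i ≠ 0)
    (hcΛ : ∀ i, c i ∈ logUnits (k i)) (b : I) (t : k b) (m : ℤ) (h : (p : ℝ) ^ m * ‖t‖ ≤ ∏ i, ‖c i‖) :
    iota p k b t • (normalizedPacket p k : Set (PacketAlgebra p k)) ⊆
      packetHull p k (((p : ℚ_[p]) ^ m) • (logPacket p k : Set (PacketAlgebra p k))) := by
  have hp0 : (0 : ℝ) < p := by exact_mod_cast hp.out.pos
  have hy : ∀ J, dEquiv p k (ppow p k m * purePacket p k c) J ≠ 0 := fun J => by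
    rw [map_mul, Pi.mul_apply]
    exact mul_ne_zero (by rw [← norm_pos_iff, norm_psi_ppow_apply]; positivity)
      (dEquiv_purePacket_ne_zero p k hc0 J)
  have hnorm : ∀ J, ‖dEquiv p k (ppow p k m * purePacket p k c) J‖ = (p : ℝ) ^ (-m) * ∏ i, ‖c i‖ := fun J => by
    rw [map_mul, Pi.mul_apply, norm_mul, norm_psi_ppow_apply, psi_purePacket_apply, norm_prod]
    simp_rw [norm_factorEmb]
  -- `ι_b(t)·(R_I)^∼ ⊆ (p^m ⊗ c)·(R_I)^∼`
  have hsub : iota p k b t • (normalizedPacket p k : Set (PacketAlgebra p k)) ⊆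
      (ppow p k m * purePacket p k c) • (normalizedPacket p k : Set (PacketAlgebra p k)) := by
    refine (smul_normalizedPacket_subset_smul_normalizedPacket_iff p k hy).mpr fun J => ?_
    rw [norm_dEquiv_iota, hnorm, zpow_neg, ← div_eq_inv_mul, le_div_iff₀ (zpow_pos hp0 _), mul_comm]
    exact h
  refine hsub.trans ?_
  rintro _ ⟨r, hr, rfl⟩
  show (ppow p k m * purePacket p k c) • r ∈
    packetHull p k (((p : ℚ_[p]) ^ m) • (logPacket p k : Set (PacketAlgebra p k)))
  rw [packetHull_apply, SetLike.mem_coe, smul_eq_mul, mul_comm]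
  refine Submodule.smul_mem _ (⟨r, hr⟩ : normalizedPacket p k) (Submodule.subset_span ?_)
  refine ⟨purePacket p k c, AddSubgroup.subset_closure ⟨c, hcΛ, rfl⟩, ?_⟩
  change ((p : ℚ_[p]) ^ m) • purePacket p k c = ppow p k m * purePacket p k c
  rw [ppow_mul_eq_smul]

/-! ## 3. The per-summand inclusion from the cell, one-sided witnesses -/

/-- **THE q-BOX LIES IN THE HULL OF THE (Ind2)-ORBIT OF THE Θ-BOX — SUFFICIENCY FROM ONE-SIDED WITNESSES.**  Per factor shell
`Λ_i = log_p(R_i^×)`: a nonzero `c^in_i` above which some `w_i ∉ Λ_i` lies (`‖w_i‖·‖ϖ_i‖ ≤ ‖c^in_i‖`; NO inner ball assumed) and a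
nonzero MEMBER `c^out_i ∈ Λ_i` (NO maximality assumed); a Θ-box `M_Θ = ι_b(t_Θ)·(R_I)^∼` (`t_Θ ≠ 0`) and a q-box `M_q = ι_{b'}(t_q)·(R_I)^∼`.
THEN `(∀ m, (∀ J, p^m·‖t_Θ‖ ≤ p^{−(d_I − d_{L_J})}·∏‖c^in_i‖) → p^m·‖t_q‖ ≤ ∏‖c^out_i‖) ⟹ M_q ⊆ hull(⋃_{γ ∈ Ind2} γ·M_Θ)`.
Proof: the orbit hull is `hull(p^{m_Θ}·log_p(R_I^×))` for the content `m_Θ` (abc-iut-w5-d180); §1 at `m_Θ`; §2.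
[cite: DupuyHilado2025, §4.9, §4.12] [cite: Mochizuki2012, IUTchIV Prop. 1.1 p. 9, Prop. 1.2 (i)(ii) p. 10] -/
theorem iota_smul_subset_packetHull_orbit_iota_smul_of_cell {cin cout : Π i, k i} (hin0 : ∀ i, cin i ≠ 0)
    (hmax : ∀ i, ∃ (ϖ : (k i)ˣ) (w : k i), IsUniformizer ϖ ∧ w ∉ logUnits (k i) ∧ ‖w‖ * ‖(ϖ : k i)‖ ≤ ‖cin i‖)
    (hout0 : ∀ i, cout i ≠ 0) (houtΛ : ∀ i, cout i ∈ logUnits (k i))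
    (b b' : I) {tΘ : k b} (htΘ : tΘ ≠ 0) (tq : k b')
    (hcell : ∀ m : ℤ, (∀ J, (p : ℝ) ^ m * ‖tΘ‖ ≤ (p : ℝ) ^ (-(dSum p k - differentOrd p (DFac p k J))) * ∏ i, ‖cin i‖) →
      (p : ℝ) ^ m * ‖tq‖ ≤ ∏ i, ‖cout i‖) :
    iota p k b' tq • (normalizedPacket p k : Set (PacketAlgebra p k)) ⊆
      packetHull p k (⋃ g : indTwo p k, g • (iota p k b tΘ • (normalizedPacket p k : Set (PacketAlgebra p k)))) := by
  set M : Set (PacketAlgebra p k) := iota p k b tΘ • (normalizedPacket p k : Set (PacketAlgebra p k)) with hM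
  have hMb : IsPsiBounded p k M := isPsiBounded_smul_normalizedPacket p k _
  have hM0 : ∃ x ∈ M, x ≠ 0 := by
    refine ⟨iota p k b tΘ, ⟨1, (normalizedPacket p k).one_mem, by
      change iota p k b tΘ • (1 : PacketAlgebra p k) = _; rw [smul_eq_mul, mul_one]⟩, fun h0 => ?_⟩
    obtain ⟨J⟩ := (inferInstance : Nonempty (DIdx p k))
    exact dEquiv_iota_ne_zero p k b htΘ J (by rw [h0, map_zero, Pi.zero_apply])
  obtain ⟨m₀, hm₀, -, hhull⟩ := exists_packetHull_orbit_eq_zpow p k hMb hM0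
  rw [hhull]
  exact iota_smul_normalizedPacket_subset_packetHull_zpow_smul_logPacket_of_le p k hout0 houtΛ b' tq m₀
    (hcell m₀ (zpow_mul_norm_le_of_iota_smul_subset_zpow_smul_logPacket p k hin0 hmax b tΘ m₀ hm₀))

/-- **The same for the FACTORWISE (Ind2)** (`⊗_i g_i`, `g_i(log_p(R_i^×)) = log_p(R_i^×)`; [IUTchIII] Thm. 3.11 (i)): the factorwise orbit
of the Θ-box has the same hull (abc-iut-w5-d180 `packetHull_factorwiseOrbit_eq_zpow`).
[cite: Mochizuki2012, IUTchIII Thm. 3.11 (i) (Ind2) p. 154] [cite: DupuyHilado2025, §4.9, §4.12] -/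
theorem iota_smul_subset_packetHull_factorwiseOrbit_iota_smul_of_cell {cin cout : Π i, k i} (hin0 : ∀ i, cin i ≠ 0)
    (hmax : ∀ i, ∃ (ϖ : (k i)ˣ) (w : k i), IsUniformizer ϖ ∧ w ∉ logUnits (k i) ∧ ‖w‖ * ‖(ϖ : k i)‖ ≤ ‖cin i‖)
    (hout0 : ∀ i, cout i ≠ 0) (houtΛ : ∀ i, cout i ∈ logUnits (k i))
    (b b' : I) {tΘ : k b} (htΘ : tΘ ≠ 0) (tq : k b')
    (hcell : ∀ m : ℤ, (∀ J, (p : ℝ) ^ m * ‖tΘ‖ ≤ (p : ℝ) ^ (-(dSum p k - differentOrd p (DFac p k J))) * ∏ i, ‖cin i‖) →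
      (p : ℝ) ^ m * ‖tq‖ ≤ ∏ i, ‖cout i‖) :
    iota p k b' tq • (normalizedPacket p k : Set (PacketAlgebra p k)) ⊆
      packetHull p k (⋃ g ∈ {g : ∀ i, k i ≃ₗ[ℚ_[p]] k i | ∀ i, g i '' logUnits (k i) = logUnits (k i)},
        (PiTensorProduct.congr g : PacketAlgebra p k ≃ₗ[ℚ_[p]] PacketAlgebra p k) ''
          (iota p k b tΘ • (normalizedPacket p k : Set (PacketAlgebra p k)))) := by
  set M : Set (PacketAlgebra p k) := iota p k b tΘ • (normalizedPacket p k : Set (PacketAlgebra p k)) with hM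
  have hMb : IsPsiBounded p k M := isPsiBounded_smul_normalizedPacket p k _
  have hM0 : ∃ x ∈ M, x ≠ 0 := by
    refine ⟨iota p k b tΘ, ⟨1, (normalizedPacket p k).one_mem, by
      change iota p k b tΘ • (1 : PacketAlgebra p k) = _; rw [smul_eq_mul, mul_one]⟩, fun h0 => ?_⟩
    obtain ⟨J⟩ := (inferInstance : Nonempty (DIdx p k))
    exact dEquiv_iota_ne_zero p k b htΘ J (by rw [h0, map_zero, Pi.zero_apply])
  obtain ⟨m₀, hm₀, hm₀1⟩ := exists_content p k hMb hM0
  obtain ⟨x, hxM, hx⟩ := Set.not_subset.mp hm₀1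
  rw [packetHull_factorwiseOrbit_eq_zpow p k hxM hx hm₀]
  exact iota_smul_normalizedPacket_subset_packetHull_zpow_smul_logPacket_of_le p k hout0 houtΛ b' tq m₀
    (hcell m₀ (zpow_mul_norm_le_of_iota_smul_subset_zpow_smul_logPacket p k hin0 hmax b tΘ m₀ hm₀))

/-! ## 4. Integer orders at a packet of pairwise isomorphic slots, INEQUALITY witnesses -/

/-- The integer heart, one direction: `e·(N / e) + R ≤ q` and `m·e ≤ N` give `e·m + R ≤ q` (`0 < e`). [folklore] -/
private theorem mul_add_le_of_ediv {e : ℤ} (he : 0 < e) {N R q : ℤ} (h : e * (N / e) + R ≤ q) {m : ℤ} (hm : m * e ≤ N) :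
    e * m + R ≤ q := by
  have hm' : m ≤ N / e := Int.le_ediv_of_mul_le he hm
  nlinarith

section Conjugate

variable {K : Type} [NontriviallyNormedField K] [NormedAlgebra ℚ_[p] K] [IsUltrametricDist K] [ProperSpace K]

/-- **THE CELL IN INTEGER ORDERS ⟹ THE INCLUSION, at a packet of pairwise isomorphic slots, with INEQUALITY witnesses.**  Slots
`τ_i : K ≃ k_i` over `ℚ_p` (Galois-conjugate completions: `d_I − min_J d_{L_J} = (|I|−1)·d_K`, abc-iut-w6-d018 / w5-d180); a positive
integer `e` and integers `D, R_in, R_out, M, m_q` with `D/e ≤ d_K` (e.g. `D = e − 1`, [IUTchIV] Prop. 1.3 (i)), nonzero `c^in_i` with an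
`hmax`-witness and `‖c^in_i‖ ≤ p^{−R_in/e}`, nonzero members `c^out_i ∈ log_p(R_i^×)` with `p^{−R_out/e} ≤ ‖c^out_i‖`, a Θ-idele with
`p^{−M/e} ≤ ‖t_Θ‖` and a q-idele with `‖t_q‖ ≤ p^{−m_q/e}`.  THEN
**`e·((M − (|I|−1)·D − |I|·R_in) / e) + |I|·R_out ≤ m_q ⟹ M_q ⊆ hull(⋃_{g factorwise} (⊗g_i)(M_Θ))`** (`/` = Int floor division).
This is the form a genuine INHABITED row evaluates: every datum of the hypothesis is a ONE-SIDED bound.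
[cite: DupuyHilado2025, §3.4, §4.9, §4.12] [cite: Mochizuki2012, IUTchIV Prop. 1.1 p. 9, Prop. 1.2 (i)(ii) p. 10, Prop. 1.3 (i) p. 11] -/
theorem iota_smul_subset_packetHull_factorwiseOrbit_iota_smul_of_orders_of_algEquiv (τ : ∀ i, K ≃ₐ[ℚ_[p]] k i) {e : ℕ}
    (he : 0 < e) {D : ℤ} (hD : (D : ℝ) / e ≤ differentOrd p K) {cin cout : Π i, k i} (hin0 : ∀ i, cin i ≠ 0)
    (hmax : ∀ i, ∃ (ϖ : (k i)ˣ) (w : k i), IsUniformizer ϖ ∧ w ∉ logUnits (k i) ∧ ‖w‖ * ‖(ϖ : k i)‖ ≤ ‖cin i‖)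
    (hout0 : ∀ i, cout i ≠ 0) (houtΛ : ∀ i, cout i ∈ logUnits (k i))
    {Rin Rout : ℤ} (hRin : ∀ i, ‖cin i‖ ≤ (p : ℝ) ^ (-((Rin : ℝ) / e))) (hRout : ∀ i, (p : ℝ) ^ (-((Rout : ℝ) / e)) ≤ ‖cout i‖)
    (b b' : I) {tΘ : k b} (htΘ : tΘ ≠ 0) {tq : k b'} {M mq : ℤ} (hΘ : (p : ℝ) ^ (-((M : ℝ) / e)) ≤ ‖tΘ‖)
    (hq : ‖tq‖ ≤ (p : ℝ) ^ (-((mq : ℝ) / e)))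
    (hcell : (e : ℤ) * ((M - (Fintype.card I - 1 : ℕ) * D - Fintype.card I * Rin) / e) + Fintype.card I * Rout ≤ mq) :
    iota p k b' tq • (normalizedPacket p k : Set (PacketAlgebra p k)) ⊆
      packetHull p k (⋃ g ∈ {g : ∀ i, k i ≃ₗ[ℚ_[p]] k i | ∀ i, g i '' logUnits (k i) = logUnits (k i)},
        (PiTensorProduct.congr g : PacketAlgebra p k ≃ₗ[ℚ_[p]] PacketAlgebra p k) ''
          (iota p k b tΘ • (normalizedPacket p k : Set (PacketAlgebra p k)))) := by
  classical
  have hp1 : (1 : ℝ) < p := by exact_mod_cast hp.out.one_lt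
  have hp0 : (0 : ℝ) < p := by linarith
  have hcard : 1 ≤ Fintype.card I := Fintype.card_pos
  have he0 : (0 : ℤ) < (e : ℤ) := by exact_mod_cast he
  have he' : (0 : ℝ) < (e : ℝ) := by exact_mod_cast he
  set n : ℕ := Fintype.card I with hn
  refine iota_smul_subset_packetHull_factorwiseOrbit_iota_smul_of_cell p k hin0 hmax hout0 houtΛ b b' htΘ tq fun m hm => ?_
  -- (a) the hypothesis at the factor of least different gives `m·e ≤ M − (n−1)·D − n·R_in`
  obtain ⟨J₀, -, hJ₀⟩ := Finset.exists_mem_eq_inf' (s := (Finset.univ : Finset (DIdx p k))) Finset.univ_nonempty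
    (fun J => differentOrd p (DFac p k J))
  have hdiff : ((n : ℝ) - 1) * ((D : ℝ) / e) ≤ dSum p k - differentOrd p (DFac p k J₀) := by
    have h := dSum_sub_inf_differentOrd_dFac_eq_of_algEquiv' p k τ
    rw [hJ₀] at h
    rw [h]
    exact mul_le_mul_of_nonneg_left hD (by rw [hn]; exact sub_nonneg.mpr (by exact_mod_cast hcard))
  have hprod_in : ∏ i, ‖cin i‖ ≤ ((p : ℝ) ^ (-((Rin : ℝ) / e))) ^ n := by
    rw [hn, ← Finset.card_univ, ← Finset.prod_const]
    exact Finset.prod_le_prod (fun i _ => norm_nonneg _) fun i _ => hRin i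
  have hstep : (p : ℝ) ^ m * (p : ℝ) ^ (-((M : ℝ) / e)) ≤
      (p : ℝ) ^ (-(((n : ℝ) - 1) * ((D : ℝ) / e))) * ((p : ℝ) ^ (-((Rin : ℝ) / e))) ^ n := by
    calc (p : ℝ) ^ m * (p : ℝ) ^ (-((M : ℝ) / e)) ≤ (p : ℝ) ^ m * ‖tΘ‖ :=
          mul_le_mul_of_nonneg_left hΘ (zpow_nonneg hp0.le _)
      _ ≤ (p : ℝ) ^ (-(dSum p k - differentOrd p (DFac p k J₀))) * ∏ i, ‖cin i‖ := hm J₀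
      _ ≤ (p : ℝ) ^ (-(((n : ℝ) - 1) * ((D : ℝ) / e))) * ((p : ℝ) ^ (-((Rin : ℝ) / e))) ^ n := by
          refine mul_le_mul (Real.rpow_le_rpow_of_exponent_le hp1.le (neg_le_neg hdiff)) hprod_in
            (Finset.prod_nonneg fun i _ => norm_nonneg _) (Real.rpow_nonneg hp0.le _)
  have hmN : m * (e : ℤ) ≤ M - (n - 1 : ℕ) * D - n * Rin := by
    rw [zpow_mul_rpow_le_rpow_mul_rpow_pow_iff p he m M Rin (((n : ℝ) - 1) * ((D : ℝ) / e)) n] at hstep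
    have h1 : -(((n : ℝ) - 1) * ((D : ℝ) / e)) * e = -(((n : ℝ) - 1) * D) := by field_simp
    rw [h1] at hstep
    have h' : ((m * (e : ℤ) : ℤ) : ℝ) ≤ ((M - (n - 1 : ℕ) * D - n * Rin : ℤ) : ℝ) := by
      push_cast; rw [Nat.cast_sub hcard]; push_cast; linarith
    exact_mod_cast h'
  -- (b) the integer cell gives `e·m + n·R_out ≤ m_q`
  have hint : (e : ℤ) * m + n * Rout ≤ mq := mul_add_le_of_ediv he0 hcell hmN
  -- (c) back to norms: `p^m·‖t_q‖ ≤ p^m·p^{−m_q/e} ≤ (p^{−R_out/e})^n ≤ ∏ ‖c^out‖`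
  have hprod_out : ((p : ℝ) ^ (-((Rout : ℝ) / e))) ^ n ≤ ∏ i, ‖cout i‖ := by
    rw [hn, ← Finset.card_univ, ← Finset.prod_const]
    exact Finset.prod_le_prod (fun i _ => Real.rpow_nonneg hp0.le _) fun i _ => hRout i
  have hfin : (p : ℝ) ^ m * (p : ℝ) ^ (-((mq : ℝ) / e)) ≤ ((p : ℝ) ^ (-((Rout : ℝ) / e))) ^ n := by
    have h := zpow_mul_rpow_le_rpow_mul_rpow_pow_iff p he m mq Rout 0 n
    rw [neg_zero, Real.rpow_zero, one_mul] at h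
    rw [h]
    have h'' : ((((e : ℤ) * m + n * Rout : ℤ)) : ℝ) ≤ ((mq : ℤ) : ℝ) := by exact_mod_cast hint
    push_cast at h''; linarith
  calc (p : ℝ) ^ m * ‖tq‖ ≤ (p : ℝ) ^ m * (p : ℝ) ^ (-((mq : ℝ) / e)) :=
        mul_le_mul_of_nonneg_left hq (zpow_nonneg hp0.le _)
    _ ≤ ((p : ℝ) ^ (-((Rout : ℝ) / e))) ^ n := hfin
    _ ≤ ∏ i, ‖cout i‖ := hprod_out

/-- **The same for Dupuy–Hilado's full (Ind2)** (`indTwo`; the two orbits of the Θ-box have the same hull, abc-iut-w5-d180).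
[cite: DupuyHilado2025, §4.9, §4.12] [cite: Mochizuki2012, IUTchIV Prop. 1.2 (i)(ii) p. 10] -/
theorem iota_smul_subset_packetHull_orbit_iota_smul_of_orders_of_algEquiv (τ : ∀ i, K ≃ₐ[ℚ_[p]] k i) {e : ℕ}
    (he : 0 < e) {D : ℤ} (hD : (D : ℝ) / e ≤ differentOrd p K) {cin cout : Π i, k i} (hin0 : ∀ i, cin i ≠ 0)
    (hmax : ∀ i, ∃ (ϖ : (k i)ˣ) (w : k i), IsUniformizer ϖ ∧ w ∉ logUnits (k i) ∧ ‖w‖ * ‖(ϖ : k i)‖ ≤ ‖cin i‖)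
    (hout0 : ∀ i, cout i ≠ 0) (houtΛ : ∀ i, cout i ∈ logUnits (k i))
    {Rin Rout : ℤ} (hRin : ∀ i, ‖cin i‖ ≤ (p : ℝ) ^ (-((Rin : ℝ) / e))) (hRout : ∀ i, (p : ℝ) ^ (-((Rout : ℝ) / e)) ≤ ‖cout i‖)
    (b b' : I) {tΘ : k b} (htΘ : tΘ ≠ 0) {tq : k b'} {M mq : ℤ} (hΘ : (p : ℝ) ^ (-((M : ℝ) / e)) ≤ ‖tΘ‖)
    (hq : ‖tq‖ ≤ (p : ℝ) ^ (-((mq : ℝ) / e)))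
    (hcell : (e : ℤ) * ((M - (Fintype.card I - 1 : ℕ) * D - Fintype.card I * Rin) / e) + Fintype.card I * Rout ≤ mq) :
    iota p k b' tq • (normalizedPacket p k : Set (PacketAlgebra p k)) ⊆
      packetHull p k (⋃ g : indTwo p k, g • (iota p k b tΘ • (normalizedPacket p k : Set (PacketAlgebra p k)))) := by
  set Mset : Set (PacketAlgebra p k) := iota p k b tΘ • (normalizedPacket p k : Set (PacketAlgebra p k)) with hMset
  have hMb : IsPsiBounded p k Mset := isPsiBounded_smul_normalizedPacket p k _
  have hM0 : ∃ x ∈ Mset, x ≠ 0 := by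
    refine ⟨iota p k b tΘ, ⟨1, (normalizedPacket p k).one_mem, by
      change iota p k b tΘ • (1 : PacketAlgebra p k) = _; rw [smul_eq_mul, mul_one]⟩, fun h0 => ?_⟩
    obtain ⟨J⟩ := (inferInstance : Nonempty (DIdx p k))
    exact dEquiv_iota_ne_zero p k b htΘ J (by rw [h0, map_zero, Pi.zero_apply])
  obtain ⟨m₀, hm₀, hm₀1⟩ := exists_content p k hMb hM0
  obtain ⟨x, hxM, hx⟩ := Set.not_subset.mp hm₀1
  rw [packetHull_orbit_eq_zpow p k hxM hx hm₀, ← packetHull_factorwiseOrbit_eq_zpow p k hxM hx hm₀]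
  exact iota_smul_subset_packetHull_factorwiseOrbit_iota_smul_of_orders_of_algEquiv p k τ he hD hin0 hmax hout0 houtΛ hRin hRout
    b b' htΘ hΘ hq hcell

end Conjugate

end Literature.IUT.LogVolume

end
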